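import Summits.AtomisticToContinuum.BoseEinsteinCondensation.Theorems.BECGroundStateSOSPeriodicIRBoundDefs
import Summits.AtomisticToContinuum.BoseEinsteinCondensation.Theorems.BECGroundStateSOSPeriodicIRBoundWFDefs
import Summits.AtomisticToContinuum.BoseEinsteinCondensation.Theorems.BECGroundStateSOSPeriodicIRBoundWFVariational
import Summits.AtomisticToContinuum.BoseEinsteinCondensation.Theorems.BECGroundStateSOSPeriodicIRBoundWFComFourier
import Summits.AtomisticToContinuum.BoseEinsteinCondensation.Theorems.BECGroundStateSOSPeriodicIRBoundWFComFourier2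
import Literature.MathematicalPhysics.QuantumManyBody.PeriodicBoseGasMomentumSector
import Literature.MathematicalPhysics.QuantumManyBody.PeriodicConfigFourier
import Mathlib.Analysis.Calculus.FDeriv.Measurable
import HarnessLib

/-! # Crux `PeriodicIRBound` (stmt-AtomisticToContinuum-3972), line `linear-ph-floor-wagner`, stub 5b `stub_wagnerFeynman` — ComGap
E2–E3: Pythagoras `𝓔[Ψ] = 𝓔[PΨ] + 𝓔[Ψ − PΨ]` and the gap of the orthogonal complement of the zero-momentum sector. -/

/-!
# Stub 5b (`stub_wagnerFeynman`), §E2–E3: Pythagoras for the centre-of-mass projection and the gap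
of the orthogonal complement

* E2 `comProj_pythagoras`: `‖Ψ‖² = ‖PΨ‖² + ‖Ψ − PΨ‖²`, `𝓔[Ψ] = 𝓔[PΨ] + 𝓔[Ψ − PΨ]` — Parseval in the
  centre of mass (`∑_q Q(Ψ_q) = Q(Ψ)` for `Q = ‖·‖², 𝓔`) applied to `Ψ` and to `Ψ − PΨ`, whose
  coefficients are `0, (Ψ_q)_{q ≠ 0}`.
* E3 `exists_gap_comProj`: `(E₀ + g)‖Ψ − PΨ‖² ≤ 𝓔[Ψ − PΨ]` with `g = min 1 (min_{q ∈ S}(E_M(2πq/L) − E₀))`,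
  `S` the non-zero dual-lattice points of a finite box outside which `|2πq/L|²/M ≥ E₀ + 1`
  (`ofReal_norm_sq_div_le_momentumSectorEnergy`); per coefficient `E_M(2πq/L)‖Ψ_q‖² ≤ 𝓔[Ψ_q]` (A2).
-/

noncomputable section

open scoped BigOperators ENNReal ComplexConjugate Topology
open Filter MeasureTheory

namespace Summit.AtomisticToContinuum.BoseEinsteinCondensation.Cruxes.PeriodicIRBound.LinearPhFloorWagner.WF

open Literature.MathematicalPhysics.QuantumManyBody.BoseGas

variable {M : ℕ} {L : ℝ}

/-! ### Parseval for the energy form -/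

/-- The kinetic density of any function is measurable. [folklore] -/
private theorem measurable_kineticDensity_wf (f : Config M → ℂ) : Measurable (kineticDensity f) := by
  refine Finset.measurable_sum _ fun i _ => Finset.measurable_sum _ fun k _ => ?_
  exact ((measurable_fderiv_apply_const ℝ f _).nnnorm.coe_nnreal_ennreal).pow_const 2

/-- `𝓔[f] = T[f] + P[f]`. -/
theorem qform_eq_kin_add_pot (w : ℝ → ℝ≥0∞) (L : ℝ) (f : Config M → ℂ) :
    qform w L f = (∫⁻ X in cellN M L, kineticDensity f X) +
      ∫⁻ X in cellN M L, periodicInteraction w L X * ((‖f X‖₊ : ℝ≥0∞)) ^ 2 :=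
  lintegral_add_left (measurable_kineticDensity_wf f) _

/-- Parseval for the energy form: `∑_q 𝓔[Ψ_q] = 𝓔[Ψ]` for a core `Ψ`. -/
theorem tsum_qform_comCoeff (hL : 0 < L) {w : ℝ → ℝ≥0∞} (hw : Measurable w) {Ψ : Config M → ℂ}
    (hΨ : IsCore L Ψ) : ∑' q : Fin 3 → ℤ, qform w L (comCoeff L Ψ q) = qform w L Ψ := by
  simp only [qform_eq_kin_add_pot]
  rw [ENNReal.tsum_add, tsum_lintegral_kineticDensity_comCoeff hL hΨ, tsum_lintegral_pot_comCoeff hL hw hΨ]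

/-- `‖0‖² = 0`. -/
theorem normSq_zero_fun (L : ℝ) : normSq L (0 : Config M → ℂ) = 0 := by
  simp [normSq]

/-- `𝓔[0] = 0`. -/
theorem qform_zero_fun (w : ℝ → ℝ≥0∞) (L : ℝ) : qform w L (0 : Config M → ℂ) = 0 := by
  have hk : ∀ X : Config M, kineticDensity (0 : Config M → ℂ) X = 0 := by
    intro X
    simp [kineticDensity, fderiv_zero]
  simp [qform, hk]

/-! ### The coefficients of `Ψ - PΨ` -/

/-- Differences of core functions are core functions. -/
theorem isCore_sub' {f g : Config M → ℂ} (hf : IsCore L f) (hg : IsCore L g) : IsCore L (fun X => f X - g X) :=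
  ⟨hf.contDiff.sub hg.contDiff, fun X i k => by simp only [hf.periodic X i k, hg.periodic X i k],
    fun σ X => by simp only [hf.symm σ X, hg.symm σ X]⟩

/-- `(Ψ − PΨ)_q = [q ≠ 0] Ψ_q`. -/
theorem comCoeff_sub_comProj (hL : 0 < L) {Ψ : Config M → ℂ} (hΨ : IsCore L Ψ) (q : Fin 3 → ℤ) :
    comCoeff L (fun X => Ψ X - comProj L Ψ X) q = if q = 0 then 0 else comCoeff L Ψ q := by
  obtain ⟨hΦc, hΦ0⟩ := isCore_comProj hL hΨ
  rw [comCoeff_sub hL hΨ.contDiff.continuous hΦc.contDiff.continuous]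
  have hΦ0' : HasTotalMomentum (latticeVec (2 * Real.pi / L) 0) (comProj L Ψ) := by
    rwa [latticeVec_zero]
  rw [comCoeff_of_hasTotalMomentum hL hΦc.contDiff.continuous hΦ0' q]
  by_cases h : q = 0
  · subst h
    simp only [if_true]
    funext X
    rw [comCoeff_zero hL hΨ.contDiff.continuous]
    exact sub_self _
  · simp only [if_neg h]
    funext X
    exact sub_zero _

/-- Pythagoras for an additive form with a centre-of-mass Parseval identity. -/
theorem pythagoras_of_parseval (hL : 0 < L) {Ψ : Config M → ℂ} (hΨ : IsCore L Ψ)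
    (Q : (Config M → ℂ) → ℝ≥0∞) (hQ0 : Q 0 = 0)
    (hP : ∀ f : Config M → ℂ, IsCore L f → ∑' q : Fin 3 → ℤ, Q (comCoeff L f q) = Q f) :
    Q Ψ = Q (comProj L Ψ) + Q (fun X => Ψ X - comProj L Ψ X) := by
  have hΦc := (isCore_comProj hL hΨ).1
  have hPc : IsCore L (fun X => Ψ X - comProj L Ψ X) := isCore_sub' hΨ hΦc
  rw [← hP Ψ hΨ, ← hP _ hPc]
  simp only [comCoeff_sub_comProj hL hΨ]
  rw [ENNReal.tsum_eq_add_tsum_ite (0 : Fin 3 → ℤ)]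
  congr 1
  · rw [comCoeff_zero hL hΨ.contDiff.continuous]
  · refine tsum_congr fun q => ?_
    by_cases h : q = 0
    · simp [h, hQ0]
    · simp [h]

/-- E2 (Pythagoras): `‖Ψ‖² = ‖PΨ‖² + ‖Ψ − PΨ‖²` and `𝓔[Ψ] = 𝓔[PΨ] + 𝓔[Ψ − PΨ]` for a core `Ψ`. -/
theorem comProj_pythagoras (hL : 0 < L) {w : ℝ → ℝ≥0∞} (hw : Measurable w) {Ψ : Config M → ℂ} (hΨ : IsCore L Ψ) :
    normSq L Ψ = normSq L (comProj L Ψ) + normSq L (fun X => Ψ X - comProj L Ψ X) ∧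
    qform w L Ψ = qform w L (comProj L Ψ) + qform w L (fun X => Ψ X - comProj L Ψ X) :=
  ⟨pythagoras_of_parseval hL hΨ (normSq L) (normSq_zero_fun L) fun _ hf => tsum_normSq_comCoeff hL hf,
    pythagoras_of_parseval hL hΨ (qform w L) (qform_zero_fun w L) fun _ hf => tsum_qform_comCoeff hL hw hf⟩

/-! ### The gap of the orthogonal complement -/

/-- A coordinate is bounded by the norm of a dual-lattice vector: `(c q_j)² ≤ ‖latticeVec c q‖²`. -/
private theorem sq_coord_le_norm_sq_latticeVec (c : ℝ) (q : Fin 3 → ℤ) (j : Fin 3) :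
    (c * q j) ^ 2 ≤ ‖latticeVec c q‖ ^ 2 := by
  rw [EuclideanSpace.norm_sq_eq]
  have h : ∀ i, ‖latticeVec c q i‖ ^ 2 = (c * q i) ^ 2 := fun i => by
    rw [Real.norm_eq_abs, sq_abs]; rfl
  calc (c * q j) ^ 2 = ‖latticeVec c q j‖ ^ 2 := (h j).symm
    _ ≤ ∑ i, ‖latticeVec c q i‖ ^ 2 :=
        Finset.single_le_sum (f := fun i => ‖latticeVec c q i‖ ^ 2) (fun i _ => by positivity) (Finset.mem_univ j)

/-- E3 (the gap of the orthogonal complement). -/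
theorem exists_gap_comProj (hL : 0 < L) {w : ℝ → ℝ≥0∞} (hw : Measurable w) (hint : (∫⁻ x : Space, w ‖x‖) ≠ ⊤)
    (hM : 1 ≤ M) (hE : periodicGroundStateEnergy w M L ≠ ⊤)
    (hgap : ∀ q : Space, q ≠ 0 → periodicGroundStateEnergy w M L < momentumSectorEnergy w M L q) :
    ∃ g : ℝ≥0∞, 0 < g ∧ ∀ Ψ : Config M → ℂ, IsCore L Ψ →
      (periodicGroundStateEnergy w M L + g) * normSq L (fun X => Ψ X - comProj L Ψ X) ≤
        qform w L (fun X => Ψ X - comProj L Ψ X) := by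
  have _hint := hint
  set E₀ : ℝ≥0∞ := periodicGroundStateEnergy w M L with hE₀
  set e0 : ℝ := E₀.toReal with he0
  set c : ℝ := 2 * Real.pi / L with hc
  have hcpos : 0 < c := by positivity
  have hMpos : (0 : ℝ) < M := by exact_mod_cast hM
  -- the box of dual-lattice points with possibly small centre-of-mass energy
  set R : ℕ := ⌈Real.sqrt (M * (e0 + 1)) / c⌉₊ with hR
  set box : Finset (Fin 3 → ℤ) := Fintype.piFinset fun _ => Finset.Icc (-(R : ℤ)) R with hbox
  set S : Finset (Fin 3 → ℤ) := box.filter (· ≠ 0) with hS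
  have hne : ∀ q : Fin 3 → ℤ, q ≠ 0 → latticeVec c q ≠ 0 := by
    intro q hq h0
    apply hq
    funext j
    have hj := sq_coord_le_norm_sq_latticeVec c q j
    rw [h0, norm_zero, zero_pow two_ne_zero] at hj
    have : (c * q j) ^ 2 = 0 := le_antisymm hj (sq_nonneg _)
    have : c * q j = 0 := pow_eq_zero_iff two_ne_zero |>.1 this
    exact_mod_cast (mul_eq_zero.1 this).resolve_left hcpos.ne'
  set gS : ℝ≥0∞ := S.inf fun q => momentumSectorEnergy w M L (latticeVec c q) - E₀ with hgS
  have hgS0 : 0 < gS := by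
    refine (Finset.lt_inf_iff (by simp : (0 : ℝ≥0∞) < ⊤)).2 fun q hq => ?_
    have hq0 : q ≠ 0 := (Finset.mem_filter.1 hq).2
    exact tsub_pos_of_lt (hgap _ (hne q hq0))
  set g : ℝ≥0∞ := min 1 gS with hg
  refine ⟨g, lt_min one_pos hgS0, fun Ψ hΨ => ?_⟩
  -- the key inequality, coefficient by coefficient
  have hkey : ∀ q : Fin 3 → ℤ, q ≠ 0 → E₀ + g ≤ momentumSectorEnergy w M L (latticeVec c q) := by
    intro q hq
    by_cases hqS : q ∈ S
    · have h1 : g ≤ momentumSectorEnergy w M L (latticeVec c q) - E₀ :=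
        (min_le_right _ _).trans (Finset.inf_le hqS)
      calc E₀ + g ≤ E₀ + (momentumSectorEnergy w M L (latticeVec c q) - E₀) := add_le_add le_rfl h1
        _ = momentumSectorEnergy w M L (latticeVec c q) := add_tsub_cancel_of_le (hgap _ (hne q hq)).le
    · -- outside the box: a coordinate exceeds `R`
      have hqbox : q ∉ box := fun h => hqS (Finset.mem_filter.2 ⟨h, hq⟩)
      obtain ⟨j, hj⟩ : ∃ j, (R : ℤ) < |q j| := by
        by_contra h
        push Not at h
        exact hqbox (Fintype.mem_piFinset.2 fun j => Finset.mem_Icc.2 (abs_le.1 (h j)))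
      have hjR : (R : ℝ) + 1 ≤ |(q j : ℝ)| := by
        have : (R : ℤ) + 1 ≤ |q j| := hj
        exact_mod_cast this
      have hRge : Real.sqrt (M * (e0 + 1)) / c ≤ R := Nat.le_ceil _
      have hreal : e0 + 1 ≤ ‖latticeVec c q‖ ^ 2 / M := by
        rw [le_div_iff₀ hMpos]
        have h2 : Real.sqrt (M * (e0 + 1)) ≤ c * |(q j : ℝ)| := by
          rw [div_le_iff₀ hcpos] at hRge
          nlinarith [hRge, hjR, hcpos]
        have h3 : M * (e0 + 1) ≤ (c * |(q j : ℝ)|) ^ 2 := by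
          calc M * (e0 + 1) = Real.sqrt (M * (e0 + 1)) ^ 2 := (Real.sq_sqrt (by positivity)).symm
            _ ≤ (c * |(q j : ℝ)|) ^ 2 := pow_le_pow_left₀ (Real.sqrt_nonneg _) h2 2
        have h4 : (c * |(q j : ℝ)|) ^ 2 = (c * q j) ^ 2 := by rw [mul_pow, mul_pow, sq_abs]
        linarith [sq_coord_le_norm_sq_latticeVec c q j, h3, h4]
      calc E₀ + g ≤ E₀ + 1 := add_le_add le_rfl (min_le_left _ _)
        _ = ENNReal.ofReal (e0 + 1) := by
            rw [ENNReal.ofReal_add ENNReal.toReal_nonneg zero_le_one, ENNReal.ofReal_toReal hE, ENNReal.ofReal_one]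
        _ ≤ ENNReal.ofReal (‖latticeVec c q‖ ^ 2 / M) := ENNReal.ofReal_le_ofReal hreal
        _ ≤ momentumSectorEnergy w M L (latticeVec c q) := ofReal_norm_sq_div_le_momentumSectorEnergy w M L _
  -- Parseval for `Ψ - PΨ` and summation
  have hPc : IsCore L (fun X => Ψ X - comProj L Ψ X) := isCore_sub' hΨ (isCore_comProj hL hΨ).1
  rw [← tsum_normSq_comCoeff hL hPc, ← tsum_qform_comCoeff hL hw hPc, ← ENNReal.tsum_mul_left]
  refine ENNReal.tsum_le_tsum fun q => ?_
  rw [comCoeff_sub_comProj hL hΨ q]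
  by_cases hq : q = 0
  · simp only [hq, if_true, normSq_zero_fun, mul_zero]
    exact bot_le
  · simp only [if_neg hq]
    obtain ⟨hcq, hmq⟩ := isCore_comCoeff hL hΨ q
    exact (mul_le_mul_left (hkey q hq) _).trans (momentumSectorEnergy_mul_normSq_le hL w hcq hmq)

end Summit.AtomisticToContinuum.BoseEinsteinCondensation.Cruxes.PeriodicIRBound.LinearPhFloorWagner.WF

end

namespace Summit.AtomisticToContinuum.BoseEinsteinCondensation.Cruxes.PeriodicIRBound.LinearPhFloorWagner

/-- The registered sub-goal `stub_wfComGap` of the crux ledger: this file's headline lemma `WF.exists_gap_comProj`. -/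
theorem stub_wfComGap : WF.Pkg.ComGap :=
  @WF.exists_gap_comProj

end Summit.AtomisticToContinuum.BoseEinsteinCondensation.Cruxes.PeriodicIRBound.LinearPhFloorWagner
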